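import Literature.MathematicalPhysics.QuantumLattice.KagomeLattice
import HarnessLib

/-!
# Discharge of `kagomeTorusGraph_adj_proj`: projecting the kagome lattice onto a kagome torus

Sibling proof file of `Literature/MathematicalPhysics/QuantumLattice/KagomeLattice.lean`; no
statement is introduced or changed.

`KagomeLattice.lean` defines the kagome lattice `kagomeGraph` on `KagomeVertex = Site 2 × Fin 3`
and the kagome tori `kagomeTorusGraph L` on `KagomeTorusVertex L = TorusSite 2 L × Fin 3`, both
generated (`SimpleGraph.fromRel`) by one adjacency table `KagomeAdjRel R` read at `R = ℤ` and at
`R = ZMod L`. Proved here: the named fact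
`Literature.MathematicalPhysics.QuantumLattice.kagomeTorusGraph_adj_proj` — for every `L : ℕ`
the projection `KagomeVertex.proj L : (x, s) ↦ (x mod L, s)` maps adjacent sites of `kagomeGraph`
to adjacent sites of `kagomeTorusGraph L` — discharged as `kagomeTorusGraph_adj_proj_holds`, and
repackaged as a Mathlib graph homomorphism `kagomeGraph →g kagomeTorusGraph L`
(`kagomeGraph_nonempty_hom_kagomeTorusGraph`).

Sources. Savary–Balents, *Quantum spin liquids: a review*, Rep. Prog. Phys. **80** (2017) 016502
(arXiv:1601.03742; section numbers below are those of the arXiv version): the kagomé lattice of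
corner-sharing triangles (§7.1.1 "Frustration": "nearest-neighbor interactions on the kagomé
(corner-sharing triangles) and triangular ("face"-sharing triangles) lattices"), the setting of
the kagomé Heisenberg antiferromagnet (§6.4.2 "Kagomé models"). The review uses the lattice and
its finite periodic clusters without isolating a lemma; what is discharged here is the elementary
structural fact, built into the design "the torus graph is the same table mod `L`" of
`KagomeLattice.lean`, that reduction mod `L` of the cell coordinates is compatible with the table.

Proof.
1. Sites related by the one-sided table lie on distinct sublattices (`kagomeAdjRel_snd_ne`: the
   first clause says `a.2 ≠ b.2`, the other three fix `(a.2, b.2) ∈ {(2, 1), (2, 0), (1, 0)}`);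
   the projection does not touch the sublattice index, so adjacent sites have distinct
   projections (`kagomeGraph_adj_snd_ne`).
2. `KagomeAdjRel.map_ringHom`: for any ring homomorphism `f : R →+* S`, applying `f` to the cell
   coordinates preserves each clause of the table, because `f ∘ (x ± eᵢ) = f ∘ x ± eᵢ`
   (`map_add`, `map_sub`, `Pi.apply_single`, `map_one`). At `f = Int.castRingHom (ZMod L)` the map
   `x ↦ f ∘ x` is `Torus.proj L` definitionally (`KagomeAdjRel.proj`).
3. `kagomeTorusGraph_adj_proj_holds` assembles 1 and 2 through `kagomeGraph_adj_iff` and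
   `kagomeTorusGraph_adj_iff` (`SimpleGraph.fromRel_adj`).
-/

namespace Literature.MathematicalPhysics.QuantumLattice

open Literature.Probability.LatticeModels

/-! ### The adjacency table: sublattices and ring homomorphisms -/

/-- Two sites related by the one-sided kagome adjacency table lie on distinct sublattices: every
clause of `KagomeAdjRel` has `a.2 ≠ b.2`. (Savary–Balents 2017, §6.4.2: the kagomé lattice;
arXiv numbering.) [cite: SavaryBalents2017, §6.4.2] -/
theorem kagomeAdjRel_snd_ne {R : Type*} [Ring R] {a b : (Fin 2 → R) × Fin 3}
    (h : KagomeAdjRel R a b) : a.2 ≠ b.2 := by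
  rcases h with ⟨-, h⟩ | ⟨h₁, h₂, -⟩ | ⟨h₁, h₂, -⟩ | ⟨h₁, h₂, -⟩
  · exact h
  all_goals rw [h₁, h₂]; decide

/-- The one-sided kagome adjacency table is preserved when a ring homomorphism `f : R →+* S` is
applied to the cell coordinates (used with `f = Int.castRingHom (ZMod L)`, reduction mod `L`):
`f ∘ (x ± eᵢ) = f ∘ x ± eᵢ`. (Savary–Balents 2017, §6.4.2: the kagomé lattice;
arXiv numbering.) [cite: SavaryBalents2017, §6.4.2] -/
theorem KagomeAdjRel.map_ringHom {R S : Type*} [Ring R] [Ring S] (f : R →+* S)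
    {a b : (Fin 2 → R) × Fin 3} (h : KagomeAdjRel R a b) :
    KagomeAdjRel S (f ∘ a.1, a.2) (f ∘ b.1, b.2) := by
  have hsingle : ∀ i : Fin 2, f ∘ (Pi.single i (1 : R) : Fin 2 → R) = Pi.single i 1 := by
    intro i
    funext j
    rw [Function.comp_apply, Pi.apply_single (fun _ => f) (fun _ => map_zero f) i 1 j, map_one]
  have hadd : ∀ (x : Fin 2 → R) (i : Fin 2),
      f ∘ (x + Pi.single i 1) = f ∘ x + Pi.single i 1 := by
    intro x i
    rw [← hsingle i]
    funext j
    simp only [Function.comp_apply, Pi.add_apply, map_add]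
  have hsub : ∀ (x : Fin 2 → R) (i : Fin 2),
      f ∘ (x - Pi.single i 1) = f ∘ x - Pi.single i 1 := by
    intro x i
    rw [← hsingle i]
    funext j
    simp only [Function.comp_apply, Pi.sub_apply, map_sub]
  unfold KagomeAdjRel
  dsimp only
  rcases h with ⟨h₁, h₂⟩ | ⟨h₁, h₂, h₃⟩ | ⟨h₁, h₂, h₃⟩ | ⟨h₁, h₂, h₃⟩
  · exact Or.inl ⟨by rw [h₁], h₂⟩
  · exact Or.inr (Or.inl ⟨h₁, h₂, by rw [h₃, hadd]⟩)
  · exact Or.inr (Or.inr (Or.inl ⟨h₁, h₂, by rw [h₃, hadd]⟩))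
  · exact Or.inr (Or.inr (Or.inr ⟨h₁, h₂, by rw [h₃, hadd, hsub]⟩))

/-- Reduction of the cell coordinates mod `L` (`KagomeVertex.proj L`, i.e. `Torus.proj L` on the
cell) preserves the one-sided kagome adjacency table. (Savary–Balents 2017, §6.4.2: the kagomé
lattice; arXiv numbering.) [cite: SavaryBalents2017, §6.4.2] -/
theorem KagomeAdjRel.proj (L : ℕ) {a b : KagomeVertex} (h : KagomeAdjRel ℤ a b) :
    KagomeAdjRel (ZMod L) (KagomeVertex.proj L a) (KagomeVertex.proj L b) :=
  h.map_ringHom (Int.castRingHom (ZMod L))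

/-! ### The projection onto the torus is a graph homomorphism -/

/-- Adjacent kagome sites lie on distinct sublattices. (Savary–Balents 2017, §6.4.2: the kagomé
lattice of corner-sharing triangles, §7.1.1; arXiv numbering.)
[cite: SavaryBalents2017, §6.4.2] -/
theorem kagomeGraph_adj_snd_ne {a b : KagomeVertex} (h : kagomeGraph.Adj a b) : a.2 ≠ b.2 :=
  ((kagomeGraph_adj_iff a b).1 h).2.elim kagomeAdjRel_snd_ne
    fun h' => (kagomeAdjRel_snd_ne h').symm

/-- **Discharge of `kagomeTorusGraph_adj_proj`.** The projection `KagomeVertex.proj L` is a graph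
homomorphism `kagomeGraph → kagomeTorusGraph L` for every `L` — adjacent sites lie on distinct
sublattices (`kagomeGraph_adj_snd_ne`), so their projections are distinct, and the adjacency table
is preserved by reduction mod `L` (`KagomeAdjRel.proj`). (Savary–Balents 2017, §6.4.2: the
kagomé lattice and its periodic clusters; arXiv numbering.)
[cite: SavaryBalents2017, §6.4.2] -/
theorem kagomeTorusGraph_adj_proj_holds : kagomeTorusGraph_adj_proj := by
  intro L a b h
  rw [kagomeTorusGraph_adj_iff]
  refine ⟨fun e => kagomeGraph_adj_snd_ne h (congrArg Prod.snd e :), ?_⟩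
  exact ((kagomeGraph_adj_iff a b).1 h).2.imp (KagomeAdjRel.proj L) (KagomeAdjRel.proj L)

/-- The projection onto the kagome torus packaged as a graph homomorphism
`kagomeGraph →g kagomeTorusGraph L` (Mathlib `SimpleGraph.Hom`). (Savary–Balents 2017, §6.4.2:
the kagomé lattice and its periodic clusters; arXiv numbering.)
[cite: SavaryBalents2017, §6.4.2] -/
theorem kagomeGraph_nonempty_hom_kagomeTorusGraph (L : ℕ) :
    Nonempty (kagomeGraph →g kagomeTorusGraph L) :=
  ⟨{ toFun := KagomeVertex.proj L, map_rel' := fun h => kagomeTorusGraph_adj_proj_holds L h }⟩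

end Literature.MathematicalPhysics.QuantumLattice
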